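import Mathlib
import HarnessLib
import HarnessLib.Audit
import Summits.SmoothPoincare4.Statement
import Literature.Topology.FourManifolds.GroupTrisections
import Literature.Topology.FourManifolds.LickorishWallace
import Literature.Topology.FourManifolds.Cobordism
import Literature.Topology.FourManifolds.SPC4HandlesProofs

/-!
Route: CongruenceShadows

DORMANT since 2026-09-04T18:33:27Z (reconciler: no traction for 5 d (last activity statement-checked at 2026-08-30T17:43:14Z); parked, not closed — `ledger route dormant route-SmoothPoincare4-CongruenceShadows --off` to reactivate) — unstaffed, not closed; items shared with open routes are served there. `ledger route dormant <id> --off` reactivates.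

# Route CongruenceShadows — formal fake 4-spheres do not exist — congruence shadows of trisections
of the trivial group are standard, and standard shadows approximate

It suffices to show X = "every Waldhausen-normalised (3+3m, m+1) group trisection of the trivial
group is stably trivial": for every m and
every kernel triple K ◁ S_g (g = 3+3m, S_g = π₁Σ_g as `SurfaceGroup`) that is a (g, m+1) group
trisection of {1} in the sense of
Abrams–Gay–Kirby and whose three Heegaard pairs (K_i, K_j) are each simultaneously standard (carried
by ONE automorphism of S_g onto the
corresponding pair of the stabilised S⁴ triple N = s4Kernels.stabilizeIter m), K is stably trivial.
X is AGK's Cor. 6 hypothesis restricted to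
normal forms; group-theoretic Waldhausen (item WaldhausenPairs) says the restriction is none, and
AGK Cor. 6 ⇐ (item AgkCor6Sufficiency, the
decl of route GroupTrisection, shared) turns it into SmoothPoincare4. Card realised:
artin-approximation-trisection-groups (spine). The cruxes
are the card's ARTIN-APPROXIMATION split of X: ShadowsStandard (every trisection of {1} is standard
in every characteristic finite quotient of
S_g — "formal fake 4-spheres do not exist") ∧ ShadowApproximation (a normalised trisection of {1}
all of whose shadows are standard IS
standard); GateLogic (support, proved in the planner sketch) is ShadowsStandard →
ShadowApproximation → X. Rev 2 (route-repair, unused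
cruxes): the unipotent split runs in parallel — NilpotentShadowsStandard (standard shadows in every
nilpotent quotient S/γ_(c+2)S) ∧
NilpotentApproximation (normalised + all nilpotent shadows standard ⇒ standard) → X — and
APPROXIMATION itself splits as closure ∧
closedness: CongruenceApproximable (ρ lies in the congruence closure of (A∩B)·C) ∧
HeegaardHandlebodyCongruenceClosed ((A∩B)·C is
congruence-closed) → ShadowApproximation; both implications form the support ArtinGates (proved in
the planner sketch).
Lean: `∀ (m : ℕ) (K : Literature.Topology.FourManifolds.TrisectionKernels (3 + 3 * m)),
Literature.Topology.FourManifolds.IsGroupTrisection (3 + 3 * m) (m + 1) (PUnit : Type) K → (∀ i j :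
Fin 3, i ≠ j → ∃ α : Literature.Topology.FourManifolds.SurfaceGroup (3 + 3 * m) ≃*
Literature.Topology.FourManifolds.SurfaceGroup (3 + 3 * m),
(Literature.Topology.FourManifolds.s4Kernels.stabilizeIter m i).map α.toMonoidHom = K i ∧
(Literature.Topology.FourManifolds.s4Kernels.stabilizeIter m j).map α.toMonoidHom = K j) →
K.IsStablyTrivial`

## Assembly
Pure logic (planner folder Sketch.lean / glue.lean, lean check rc 0, axioms propext /
Classical.choice / Quot.sound): AgkCor6Sufficiency asks for
`∀ k K, IsGroupTrisection (3k) k PUnit K → K.IsStablyTrivial`; for k = 0 this is GenusZero; for k =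
m+1 rewrite 3(m+1) = 3+3m (subst on a
generalised genus), and NormalFormStablyTrivial m K hK (WaldhausenPairs m K hK) closes it;
AgkCor6Sufficiency then returns literally
`_root_.SmoothPoincare4 = Literature.SPC4.SmoothPoincareConjectureFour.{0}`:
`theorem closes (hX : NormalFormStablyTrivial) (hW : WaldhausenPairs) (h0 : GenusZero) (hAGK :
AgkCor6Sufficiency) : _root_.SmoothPoincare4`.
The research cruxes ShadowsStandard / NilpotentShadowsStandard / ShadowApproximation /
HeegaardHandlebodyCongruenceClosed, the crux-grade
supports CongruenceApproximable / NilpotentApproximation and the supports GateLogic / ArtinGates /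
AbelianShadowStandard are the ranked
rungs towards hX and are not hypotheses of `closes`; every crux feeds hX through a sketch-proved
logic gate: GateLogic:
ShadowsStandard → ShadowApproximation → hX; ArtinGates = (CongruenceApproximable →
HeegaardHandlebodyCongruenceClosed →
ShadowApproximation) ∧ (NilpotentShadowsStandard → NilpotentApproximation → hX) (planner folder
Sketch.lean, rc 0).

Rationale: WHY THIS LINE. Abrams–Gay–Kirby (AbramsGayKirby2018 Thm 5, Cor 6 = arXiv:1605.06731 p.3) make SPC4 a
statement about triples of handlebody subgroups of the
surface group S_g up to Aut S_g; after Waldhausen-normalising two of the three Heegaard pairs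
(Waldhausen1968, GrigorchukKurchanov1990,
LeiningerReid2002, Perelman via AGK p.4) a homotopy-sphere trisection is one handlebody subgroup
ρ(N₂) relative to the standard pair (N₀,N₁), and
it is S⁴'s iff ρ ∈ (A∩B)·C (A, B, C the stabilisers). The card transplants commutative algebra's
"formal ⇒ actual" (Artin1969) to this
configuration: complete S_g (here: its characteristic finite quotients = the congruence topology on
Aut S_g; its lower central quotients for
the card's unipotent half) and split X into BLIND (completed trisections of the trivial group are
standard: the Nakayama move that makes the
finitary Andrews–Curtis conjecture a theorem, BorovikLubotzkyMyasnikov2005 / Myropolska2013 Thm 1.2,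
plus Dunfield–Thurston mixing of Mod on
Epi(S_g,Q), DunfieldThurston2005 Thm 7.4) and APPROXIMATION (standard shadows ⇒ standard), which
lives in the profinite theory of Mod(Σ_g):
separability of handlebody and Heegaard groups (LeiningerMcreynolds2005 Thm 1.3/Cor 1.4),
procongruence curve-complex rigidity (Boggi2014,
BoggiFunar2020), CSP (arXiv:2410.00556). Imported area: profinite / pro-nilpotent group theory of
mapping class groups; the nearest precedent
one dimension down is Hain2008 (completed handlebody double cosets for Heegaard splittings). What no
prior route does: GroupTrisection attacks
the genus-3 rung discretely (Nielsen moves, Morse shadows); here every genus is split into a formal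
half decidable without SPC4 and an
approximation half statable inside Aut S_g. Planner's correction to the card (NOTES.md): the card's
CONG ("pro-stabiliser of N̂ = closure of
the handlebody group") is FALSE at every genus by profinite-unit twists diag(u,u⁻¹) on a genus-1
subsurface (the congruence analogue of Hain2008
§10: Λ_U is not dense in M₀^U); its discrete approximants are lens-space splittings, not trisections
of {1}, so the approximation crux is filed
RESTRICTED to group trisections of the trivial group (ShadowApproximation) and CONG is not filed.

RANKED CRUXES. #0 NormalFormStablyTrivial (target) — for every m, every (3+3m, m+1) group trisection
K of the trivial group whose three pairs (K_i,K_j), i ≠ j, are each the image of the standard pair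
(N_i,N_j) (N = s4Kernels.stabilizeIter m) under one automorphism of S_(3+3m) is stably trivial
(card: stable GATE, kernel form). (why it might fail: Given WaldhausenPairs it is AGK's X ⇔ SPC4:
false iff an exotic 4-sphere exists (Gluck twists of non-ribbon 2-knots, Cappell–Shaneson spheres,
cork doubles); already its unstable genus-3 case contains 4-dimensional Waldhausen.)
[AbramsGayKirby2018, arXiv:1605.06731, GayKirby2016, MeierSchirmerZupan2016,
Literature.Topology.FourManifolds.spc4_iff_forall_isStablyTrivial]
#2 AgkCor6Sufficiency (crux) — Abrams–Gay–Kirby Cor. 6, direction ⇐, universe 0, kernel form: if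
every (3k,k) kernel triple that is a group trisection of the trivial group is stably trivial, then
every Hausdorff second-countable smooth 4-manifold homotopy equivalent to S⁴ is diffeomorphic to S⁴.
IDENTICAL signature to route GroupTrisection's item (shared decl; fact debt listed first: the ⇐ half
of the named fact spc4_iff_forall_isStablyTrivial, proved in tree from GK/AGK leaves of which three
are open). [difficulty: XL] (why it might fail: Published theorem (AGK Cor 6 ⇐ via GK Thm 4 + AGK
Thm 5); risk = vendoring fidelity of its 3 open leaves exists_isBalancedGKTrisection /
diffeomorph_of_iso_groupGKTrisectionOf / exists_stabilized_gkTrisection (a first vendoring WAS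
refuted in tree) and depth (Cerf theory, Laudenbach–Poénaru).) [AbramsGayKirby2018,
arXiv:1605.06731, GayKirby2016, LaudenbachPoenaru1972,
Literature.Topology.FourManifolds.spc4_iff_forall_isStablyTrivial,
Literature.Topology.FourManifolds.spc4_of_forall_isStablyTrivial_of_facts]
#2 WaldhausenPairs (crux) — group-theoretic Waldhausen (card P2, made load-bearing): for every
(3+3m, m+1) group trisection K of the trivial group and every i ≠ j there is ONE automorphism α of
S_(3+3m) with α(N_i) = K_i and α(N_j) = K_j. Route: K_i = ker of a geometric epimorphism onto F_g
(GrigorchukKurchanov1990, LeiningerReid2002), H_i ∪ H_j is closed with π₁ free of rank m+1 hence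
#(S¹×S²) (Kneser–Stallings + Perelman, as in AGK p.4), Waldhausen: its genus-g splitting is
standard, i.e. diffeomorphic to the (i,j) pair of the standard trisection of S⁴; Dehn–Nielsen turns
the diffeomorphism into α. [difficulty: XL] (why it might fail: A theorem only through 3-manifold
topology: geometric epimorphisms (GK90/LR02), Kneser–Stallings plus PERELMAN (free π₁ ⇒ #S¹×S²),
Waldhausen 1968; no algebraic proof exists (Stallings' 'how not to prove Poincaré') and none of it
is in Mathlib — vendoring depth XL, mis-vendoring is the live risk.) [Waldhausen1968,
GrigorchukKurchanov1990, LeiningerReid2002, Jaco1969, Perelman2002Entropy, Perelman2003a,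
AbramsGayKirby2018, Nielsen1927, ZieschangVogtColdewey1980]
#3 ShadowsStandard (crux) — BLIND, congruence form (card K2): for every (3+3m, m+1) group trisection
K of the trivial group and every characteristic finite-index M ≤ S = S_(3+3m) there is ψ ∈ Aut S
with ψ(N_i)·M = K_i·M for i = 0,1,2 — in every characteristic finite quotient of the surface group
the shadow of a trisection of {1} is the shadow of the standard trisection of S⁴ ("formal fake
4-spheres do not exist"; also no formally non-standard trisection of S⁴). [difficulty: L] (why it
might fail: Dunfield–Thurston mixing (Thm 7.4) is per simple quotient and only for g ≫ |Q|; solvable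
layers and simultaneity across strata are uncontrolled; one characteristic quotient (onto A₅,
PSL₂(7), a 2-group) separating the standard (6;2,2,2) trisection of S⁴ from a Gluck-twist trisection
refutes it.) [DunfieldThurston2005, BorovikLubotzkyMyasnikov2005, Myropolska2013,
AbramsGayKirby2018, FellerEtAl2017, arXiv:1605.06731]
#4 NilpotentShadowsStandard (crux) — BLIND, nilpotent form (the typable discrete analogue of card
K1): for every (3+3m, m+1) group trisection K of the trivial group and every c there is ψ ∈ Aut S
with ψ(N_i)·γ_(c+2)S = K_i·γ_(c+2)S (γ = lower central series, γ_(c+2)S = `(⊤).lowerCentralSeries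
(c+1)`), i.e. the shadows in every nilpotent quotient S/γ_(c+2)S are standard; c = 0 is the abelian
(Lagrangian-triple) shadow. [difficulty: L] (why it might fail: Stronger than the card's Lie-level
K1: equivalence under the IMAGE of Aut S_g in Aut(S/γ), an arithmetic group — Johnson-image (Morita
trace) and class-number obstructions may separate orbits that the graded gate identity (defect 0 in
the card's ten computed cases) cannot see.) [Lambertcole2019, Hain2008, FellerEtAl2017,
arXiv:1901.10834, ZieschangVogtColdewey1980]
#5 ShadowApproximation (crux) — APPROXIMATION (replaces card K3 ∧ K4 on the load path): a
Waldhausen-normalised (3+3m, m+1) group trisection K of the trivial group all of whose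
characteristic finite shadows are standard is standard: Iso N K (unstably, at its own genus). With
ShadowsStandard this is the unstable gate AC ∩ BC ∩ T = (A∩B)C of the card, hence X (GateLogic).
[deps: ShadowsStandard] [difficulty: open-problem] (why it might fail: It is SPC4_g ∧
4-d-Waldhausen_g at each genus: a non-standard balanced trisection of S⁴ itself (MSZ Conj 3.11,
'likely false') with standard shadows refutes it without touching SPC4; and completed stabilisers
exceed closures by Ẑˣ-twists (NOTES), so no proof via 'pro-stabiliser = closure' exists.)
[Artin1969, Hain2008, Boggi2014, BoggiFunar2020, LeiningerMcreynolds2005, MeierSchirmerZupan2016,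
arXiv:2410.00556]
#6 HeegaardHandlebodyCongruenceClosed (crux) — SEP (card K4, congruence form, off the load path but
its cleanest sub-question): the product set (A∩B)·C ⊆ Aut S_(3+3m) — A∩B the stabiliser of the
standard pair (N₀,N₁) (a genus-g Heegaard group of #(S¹×S²)), C the stabiliser of N₂ (a handlebody
group) — is closed in the congruence topology: an automorphism ρ congruent modulo every
characteristic finite-index M to some product x∘c is itself a product x∘c. [difficulty:
open-problem] (why it might fail: Each factor is congruence-closed (Hopfian argument) and separable
(L–McR Cor 1.4), but products of closed subgroups need not be closed (Ribes–Zalesskii is special to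
free groups), Stab(N̂) ⊋ cl(C) by unit twists, and congruence-closed exceeds profinitely-closed
unless CSP(Mod_g), open for g ≥ 3.) [LeiningerMcreynolds2005, RibesZalesskii1993, Scott1978,
Boggi2014, arXiv:2410.00556, arXiv:math/0505225]
#9 GateLogic (support) — the Artin split is sound: ShadowsStandard → ShadowApproximation →
NormalFormStablyTrivial (given K normalised, BLIND supplies standard shadows, APPROXIMATION gives
Iso N K =: α, and IsStablyTrivial holds with n = 0 via α⁻¹). Proved in the planner folder
(Sketch.lean, theorem gateLogic_holds, lean check rc 0): copy it. [difficulty: provable-now]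
[AbramsGayKirby2018, Artin1969]
#9 GenusZero (support) — the k = 0 case of AGK's hypothesis: every (0,0) group trisection of the
trivial group (kernel triple in the trivial group S₀) is stably trivial — one stabilisation is
literally s4Kernels transported along genShift 0 (Fin.natAdd 0 = id propositionally) and 3 + 3·0 = 0
+ 3·1. [difficulty: provable-now] [AbramsGayKirby2018,
Literature.Topology.FourManifolds.s4Kernels_isStablyTrivial]
#9 AbelianShadowStandard (support) — the c = 0 rung of NilpotentShadowsStandard, provable by
integral symplectic linear algebra once H₁ of the presented surface group is identified with ℤ^(2g):
the Lagrangian triple (L₀,L₁,L₂) ⊆ H₁(Σ_g;ℤ) of a (3+3m, m+1) group trisection of the trivial group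
(pairwise sums co-free of rank m+1, total sum everything; FKSZ: H_*(X) = H_*(S⁴)) is carried to the
standard triple by an automorphism of S_g (Aut S_g ↠ Sp±(2g,ℤ)). [difficulty: M] [FellerEtAl2017,
arXiv:1711.04762, ZieschangVogtColdewey1980]
#9 CongruenceApproximable (support, CRUX-GRADE; rev 2, rank 9 only because of the 7-crux cap) —
APPROXIMATION, closure form: under the hypotheses of ShadowApproximation there are α (αN₀ = K₀, αN₁
= K₁) and ρ (αρN₂ = K₂) with ρ ≡ x∘c mod every characteristic finite-index M, x ∈ Stab N₀ ∩ Stab N₁,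
c ∈ Stab N₂ exact (re-chosen per level): ρ lies in the congruence closure of (A∩B)·C.
ShadowApproximation ⇒ it; it ∧ HHCC ⇒ ShadowApproximation (ArtinGates.1). [difficulty: open-problem]
(why it might fail: Shadows give only LEVEL symmetries, and LevelSymmetriesLift /
NormalisedLevelSymmetriesLift are FALSE (unit twists, Alexander units: ShadowApproximation Disproof
§6–10), so x_M, c_M must be re-chosen per level; one level where im(A∩B)·ψ_M·im(C) holds no product
for a homotopy-S⁴ trisection kills it.) [Artin1969, LeiningerMcreynolds2005, arXiv:math/0505225,
Hain2008, arXiv:2206.10687, arXiv:2410.00556, MeierSchirmerZupan2016]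
#9 NilpotentApproximation (support, CRUX-GRADE; rev 2) — APPROXIMATION, unipotent form (card K5
without a uniform depth): a normalised (3+3m, m+1) group trisection of {1} all of whose nilpotent
shadows are standard (verbatim the conclusion of NilpotentShadowsStandard) is standard: Iso N K;
with NilpotentShadowsStandard, X (ArtinGates.2). [difficulty: open-problem] (why it might fail: It
is SPC4_g ∧ 4-d-Waldhausen_g on its locus (a non-standard trisection of S⁴ with standard nilpotent
shadows refutes it); the standardisations ψ_c need not stabilise in c — no finite class sees deep
Johnson-kernel regluing and nothing bounds the depth (card K5: depth 1 is SPC4_g).)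
[arXiv:1901.10834, Lambertcole2019, Hain2008, arXiv:2401.07705, AbramsGayKirby2018,
MeierSchirmerZupan2016]
#9 ArtinGates (support, rev 2) — (CongruenceApproximable → HeegaardHandlebodyCongruenceClosed →
ShadowApproximation) ∧ (NilpotentShadowsStandard → NilpotentApproximation →
NormalFormStablyTrivial): HHCC makes ρ = x∘c and φ := α∘x carries N to K; the second conjunct is
GateLogic's proof verbatim. Sketch.lean artinGates_holds, rc 0: copy it. [difficulty: provable-now]
[Artin1969, AbramsGayKirby2018]

TWO-LAYER PLAN. Foreseen glued splits (none filed now; k ≤ 3, depth 1): ShadowsStandard ⇐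
AbelianLevel (M ⊇ [S,S]S^n: symplectic linear algebra over ℤ/n) →
NilpotentLevel (S/M nilpotent: Hensel iteration of the card's Lie gate identity) → SimpleLevel (M =
⋂ ker(S ↠ Q), Q simple: Dunfield–Thurston
alternating monodromy on Epi(S_g,Q)/Aut Q with |Hom(π₁X,Q)| = 1) → ShadowsStandard (the glue is the
Jordan–Hölder-type induction over a chief
series of S/M). ShadowApproximation ⇐ CongruenceApproximable →
HeegaardHandlebodyCongruenceClosed∩gate → ShadowApproximation — FILED flat at rev 2
(CongruenceApproximable + ArtinGates.1; unrestricted HHCC implies its gate-locus form; not a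
--split, so HHCC keeps a layer for its own
split and the crux cap is respected). NilpotentShadowsStandard → X FILED at rev 2
(NilpotentApproximation + ArtinGates.2; K5 = its
uniform-depth strengthening). NilpotentShadowsStandard ⇐ AbelianShadowStandard → JohnsonDescent
(Lambert-Cole's Johnson-kernel
regluing) → NilpotentShadowsStandard.

KILL CRITERIA. - NormalFormStablyTrivial refuted (a normalised trisection of {1} not stably trivial
= an exotic 4-sphere by AGK Thm 5 + WaldhausenPairs) ⇒ ¬SPC4:
  closes this and every positive SmoothPoincare4 route (close --reason
refuted:NormalFormStablyTrivial).
- ShadowsStandard refuted by a homotopy-sphere trisection whose shadow in some characteristic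
quotient is non-standard: the formal half is dead
  but the witness is a COMPUTABLE finite-group trisection invariant outside every catalogued
blindness class — pivot the route to the negative
  side (file ¬SPC4-detection items) or close refuted:ShadowsStandard if the witness is S⁴ itself
with a non-standard shadow (then the blindness
  thesis is simply wrong).
- ShadowApproximation refuted at genus g by a non-standard trisection OF S⁴ with standard shadows
(¬4-d-Waldhausen_g): NOT fatal — restate
  stably (conclusion K.IsStablyTrivial instead of Iso N K) by `--restate`; refuted by an exotic
sphere: fatal as above.
- HeegaardHandlebodyCongruenceClosed refuted off the gate locus: restate it restricted to the locus
(all ArtinGates uses); on the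
  locus it refutes ShadowApproximation too. CongruenceApproximable refuted ⇒ ¬ShadowApproximation at
that genus: same dichotomy
  (non-standard trisection of S⁴ ⇒ restate both stably; exotic sphere ⇒ fatal).
NilpotentApproximation refuted by a non-standard
  trisection of S⁴ with standard nilpotent shadows: restate stably or drop it and restate ArtinGates
as its first conjunct (the
  congruence half is independent).
- NilpotentShadowsStandard refuted at some class c by an arithmetic (Johnson-image) obstruction on a
trisection of S⁴ or of a homotopy sphere:
  drop/restate at the Lie level (card K1 proper, needs the definition request below); the congruence
crux ShadowsStandard is independent.
- WaldhausenPairs / AgkCor6Sufficiency cannot be refuted mathematically (published theorems); an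
in-tree refutation means a mis-stated
  signature — repair the statement (restate), not the route.
- Mooted if any route proves SmoothPoincare4; superseded by nothing currently open (GroupTrisection
shares only the AGK frame).

NOT DECOMPOSED YET. - The card's Lie-level K1 (Malcev/graded gate identity (𝔞+𝔠)∩(𝔟+𝔠) = (𝔞∩𝔟)+𝔠 in
Der⁺ of the surface Lie algebra, pair lemma, Hensel
  iteration) — needs the surface Lie algebra and its derivation algebra as Literature definitions
(request below); filed informally after open.
- The card's K3 (CONG: pro-stabilisers = closures) — deliberately NOT filed: false by profinite-unit
twists (NOTES.md §KEY FINDING; Hain2008 §10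
  is the unipotent precedent); its true discrete shadow (Aut S ∩ Stab(N̂) = Stab N, Hopfian
argument, card P4) is routine and not an item.
- The card's K5 (DET_g, uniform depth m(g)) — the uniform-depth strengthening of
NilpotentApproximation; a child only once a depth
  bound is plausible (depth 1 is SPC4_g). The level-wise split of CongruenceApproximable
(unit-scalar then Alexander-unit torsors,
  ShadowApproximation Disproof §6/§10) — left to the crux chain.
- Per-genus unstable gates, the (6;2,2,2) computations, and the negative companions
(¬ShadowsStandard as an invariant) — filed only when a
  refuter produces a witness.
- Stable forms of ShadowsStandard / ShadowApproximation (after stabilizeIter n) — only if an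
unstable form dies to a non-standard trisection of S⁴.

CHEAPEST FALSIFIER. GAP/kit enumeration at genus 6 (m = 1): for Q ∈ {A₅, PSL₂(7), the free 2-step
nilpotent 2-group of exponent 4 on 12 generators truncated} and
M = ⋂ ker(S₆ ↠ Q), compare the M-shadow (three subgroups of the finite group S₆/M up to the image of
Aut S₆) of the standard (6;2,2,2)
trisection of S⁴ with that of the Gay–Meier (6;2,2,2) trisection of the Gluck twist of a spun
trefoil (≅ S⁴, so under ShadowsStandard they MUST
agree; a disagreement refutes ShadowsStandard AND 4-d Waldhausen at genus 6 and hands over an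
invariant). Not run here (plancard seat, no kit
payload; the card's author queued Lie-level replicas j003169/j003171/j003223). Second cheapest: the
abelian rung AbelianShadowStandard by hand
(integral Lagrangian triples with homology-sphere numerics are standard?) — a counterexample there
kills NilpotentShadowsStandard at c = 0.

NUMBERS. - Solved range (LowGenusTrisectionBarrier): trisection genus ≤ 2 standard (MeierZupan2017);
some kᵢ ≥ g−1 standard (MeierSchirmerZupan2016 Thm 1.2);
  homotopy 4-spheres have g = 3k, first open type (3;1,1,1) = m = 0 here.
- Card's Lie-level evidence (exp/gate_identity.py, exact linear algebra over F_p): gate defect 0 and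
pair defect 0 at (g,n) = (3,1…5), (6,1…3),
  (9,1…2), ambient dimensions up to 13770; punctured control 0 throughout.
- Dunfield–Thurston Thm 7.4: for Q simple and g ≫ 0 the action of Mod_g on each H₂-class orbit of
Epi(S_g,Q)/Aut Q is the full alternating group;
  no explicit genus bound ('we suspect g ≥ 3').
- Units obstruction (NOTES): for every prime ℓ ≡ ±3 mod 8, ℓ ≥ 5, and every characteristic
finite-index M ≤ S_g there is ψ ∈ Aut S_g stabilising
  N₀M and N₁M whose action on L₀ ⊗ F_ℓ has determinant 2 ∉ {±1} — so level stabilisers are never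
A·K_M; items avoid level stabilisers of single handlebodies.
- Items at open: 11 (1 target, 6 cruxes of which 2 fact debt, 3 support, 1 assembly); cone:
GroupTrisections.lean only (both named facts there discharged).
- Items at rev 2: 15 = 1 target + 6 cruxes + 6 typed supports (2 crux-grade) + 1 informal support +
1 assembly (gate caps 15/7 met);
  closes unchanged; cone unchanged.

DEFINITION REQUESTS. - SurfaceLieAlgebra g (the graded ℤ- or ℚ-Lie algebra
Free(a₁…a_g,b₁…b_g)/(Σ[aᵢ,bᵢ]) = associated graded of the lower central series of S_g,
  Labute) with its positive-degree derivations Der⁺ and the three coordinate stabiliser subalgebras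
of the s4Kernels Lagrangians — topic
  Literature/Algebra/Lie or Literature/Topology/FourManifolds; needed to type the card's K1 (Lie
gate identity). Filed after open with
  `ledger workitem add --kind definition`.
- Cite facts wanted (for WaldhausenPairs): Waldhausen1968 (Heegaard splittings of #ᵏS¹×S² are
standard), GrigorchukKurchanov1990
  (epimorphisms S_g ↠ F_g unique up to Aut S_g), Kneser–Stallings–Perelman (closed orientable
3-manifold with free π₁ of rank k is #ᵏS¹×S²).

Novelty: Searches (2026-08-15, this seat; local searchd down rc 75, OpenAlex budget exhausted, S2 429 after
one query): `lit search --source s2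
"procongruence mapping class group"` (8: Boggi2020 arXiv:2011.15075, BoggiFunar2020
arXiv:2004.04135, Boggi–Funar–Lochak, Kent 2011 congruence
kernels, …; none on handlebody/trisection shadows); `lit search --source zbmath "handlebody group
separable"` (2: LeiningerMcreynolds2005,
Thurston 1982); `lit search --source zbmath "Heegaard splitting profinite"` (0); `--source zbmath
"trisection 4-manifold invariant finite group"` (0);
`--source arxiv "procongruence handlebody"`, `"trisection Dijkgraaf Witten invariant"`, `"congruence
subgroup property handlebody mapping class
group"` (0 each); `--source crossref "Artin approximation mapping class group trisection"` (8, all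
irrelevant); `lit galaxy search --star all`
for "group trisection" (0/0/0), "trisections of 4-manifolds" (0/0/0), "procongruence" (1
irrelevant), "handlebody group" (panama 4 incl. Farb's
Problems volume; pdf 4 incl. Hain2008 = arXiv:0802.0814 READ: §1, §10 Thm 10.3, §11 Thm 11.1),
"congruence subgroup problem for mapping class"
(0); `lit read arxiv:1605.06731` pp.3–4 (AGK's use of LR02, Kneser–Stallings, Perelman,
Laudenbach–Poénaru, Waldhausen); `lit read
arxiv:math/0502567` Thm 7.1/7.4. Plus the card's own log (lit search arxiv "trisection Torelli…" 2
hits, galaxy "trisection Torelli" 0, CSP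
searches → arXiv:2410.00556, 2408.12486, 2411.06867).
Nearest prior art found: Hain2008  [refs: 2011.15075, 2004.04135, 0802.0814, 1605.06731, math/0502567, 2410.00556, arxiv:1605.06731, arxiv:math/0502567, Boggi2020, BoggiFunar2020, LeiningerMcreynolds2005, Hain2008, AbramsGayKirby2018, BorovikLubotzkyMyasnikov2005, Myropolska2013, Boggi2014, Lambertcole2019, DunfieldThurston2005]

Barriers (technique_class: trisection-group completions, artin-approximation): - technique_class: trisection-group completions, artin-approximation
- Literature.Barriers.SmoothPoincare4.LowGenusTrisectionBarrier: bounds the route from below, does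
not block it — all items live at balanced type (3+3m; m+1,m+1,m+1), m ≥ 0, i.e. from (3;1,1,1) on,
exactly the first type outside the Meier–Zupan / MSZ range named in the barrier's evasions_known
(the same holds for the uncatalogued LargeKTrisectionBarrier: kᵢ = m+1 ≤ g−2); its scope caveat (b)
(vacuous IsTrisection predicates) is void here: every item is over GroupTrisections.lean (kernel
triples), inhabited by s4Kernels_isGroupTrisection_holds. Honest bet recorded here:
ShadowApproximation (and SEP) at one genus carry SPC4_g ∧ 4-d-Waldhausen_g, so they are SPC4-deep or
false; the claim is that they are statable and gradable inside the congruence theory of Aut S_g,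
while ShadowsStandard / NilpotentShadowsStandard / AbelianShadowStandard are decidable without SPC4.
- Literature.Barriers.SmoothPoincare4.HCobordismInvariantBarrierFour: not in class — no
h-cobordism-invariant (or S²×S²-stable, StableBarrierFour; or homeomorphism-invariant,
TopologicalBarrierFour) quantity of Σ is evaluated; the statements are identities between
Aut(S_g)-orbits of subgroup triples at FIXED genus, and kernel triples of smooth trisections do
distinguish smooth structures in general (BlackwellEtAl2023 p.42); conceded — and used only as a
crux to be PROVED, never as a detector — that a finite shadow read as an invariant of Σ would be b

History (route lifecycle, newest last):
- 2026-08-16T04:17:57Z · AUTO-CRUX (backfill): NormalFormStablyTrivial — hypotheses of the deciding theorem that nothing in the route derives are cruxes (operator:999:1085951)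
- 2026-08-23T14:42:28Z · DORMANT — reconciler: no traction for 6 d (last activity item-evidence-added at 2026-08-17T12:41:32Z); parked, not closed — `ledger route dormant route-SmoothPoincare4-Co (operator:999:1314795)
- 2026-08-30T17:13:38Z · REACTIVATED (open) — reconciler: reactivated — activity statement-checked at 2026-08-30T16:13:55Z after parking at 2026-08-23T14:42:28Z (operator:999:667219)
- 2026-09-04T18:33:27Z · DORMANT — reconciler: no traction for 5 d (last activity statement-checked at 2026-08-30T17:43:14Z); parked, not closed — `ledger route dormant route-SmoothPoincare4-Cong (operator:999:2126865)

sub-problem: SmoothPoincare4 · status: dormant · opened planner-plancard-SmoothPoincare4-SmoothPoinca-27299605-0 2026-08-15T19:09:54Z · rev 5 · ledger route-SmoothPoincare4-CongruenceShadows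
GENERATED by the gate from the ledger (D-0016/17). Provers cite these decls: `theorem foo : Summit.SmoothPoincare4.SmoothPoincare4.Theses.CongruenceShadows.<Decl> := …` in Summits/SmoothPoincare4/SmoothPoincare4/Theorems/<Name>.lean.
-/

namespace Summit.SmoothPoincare4.SmoothPoincare4.Theses.CongruenceShadows

open scoped BigOperators Topology Manifold Classical MeasureTheory ProbabilityTheory Matrix InnerProductSpace ComplexConjugate ContinuousMap
open Filter Set Function TopologicalSpace MeasureTheory

attribute [summit_statement] _root_.SmoothPoincare4

open Literature.SPC4

/-- item stmt-SmoothPoincare4-14591 · crux (kind.auto-crux: conjecture-grade) · rank 0 · open · by planner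
why it might fail: Given WaldhausenPairs it is AGK's X ⇔ SPC4: false iff an exotic 4-sphere exists (Gluck twists of non-ribbon 2-knots, Cappell–Shaneson spheres, cork doubles); already its unstable genus-3 case contains 4-dimensional Waldhausen.
sources: AbramsGayKirby2018, arXiv:1605.06731, GayKirby2016, MeierSchirmerZupan2016, Literature.Topology.FourManifolds.spc4_iff_forall_isStablyTrivial
[target] for every m, every (3+3m, m+1) group trisection K of the trivial group whose three pairs
(K_i,K_j), i ≠ j, are each the image of the standard pair (N_i,N_j) (N = s4Kernels.stabilizeIter m)
under one automorphism of S_(3+3m) is stably trivial (card: stable GATE, kernel form). -/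
@[route_item "route-SmoothPoincare4-CongruenceShadows"]
def NormalFormStablyTrivial : Prop :=
  ∀ (m : ℕ) (K : Literature.Topology.FourManifolds.TrisectionKernels (3 + 3 * m)), Literature.Topology.FourManifolds.IsGroupTrisection (3 + 3 * m) (m + 1) (PUnit : Type) K → (∀ i j : Fin 3, i ≠ j → ∃ α : Literature.Topology.FourManifolds.SurfaceGroup (3 + 3 * m) ≃* Literature.Topology.FourManifolds.SurfaceGroup (3 + 3 * m), (Literature.Topology.FourManifolds.s4Kernels.stabilizeIter m i).map α.toMonoidHom = K i ∧ (Literature.Topology.FourManifolds.s4Kernels.stabilizeIter m j).map α.toMonoidHom = K j) → K.IsStablyTrivial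

/-- item stmt-SmoothPoincare4-10894 · crux · rank 2 · open · by planner
why it might fail: Published theorem (AGK Cor 6 ⇐ via GK Thm 4 + AGK Thm 5); risk = vendoring fidelity of its 3 open leaves exists_isBalancedGKTrisection / diffeomorph_of_iso_groupGKTrisectionOf / exists_stabilized_gkTrisection (a first vendoring WAS refuted in tree) and depth (Cerf theory, Laudenbach–Poénaru).
sources: AbramsGayKirby2018, arXiv:1605.06731, GayKirby2016, LaudenbachPoenaru1972, Literature.Topology.FourManifolds.spc4_iff_forall_isStablyTrivial, Literature.Topology.FourManifolds.spc4_of_forall_isStablyTrivial_of_facts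
[crux] Abrams–Gay–Kirby Cor. 6, direction ⇐, at universe 0 and in kernel form: if every (3k,k)
kernel triple K that is a group trisection of the trivial group is stably trivial, then every
Hausdorff second-countable smooth 4-manifold homotopy equivalent to S⁴ is diffeomorphic to S⁴.
Verbatim the ⇐ half of the body of the named fact
`Literature.Topology.FourManifolds.spc4_iff_forall_isStablyTrivial` (TrisectionFunctor.lean:291),
whose module the route deliberately does not import; PROVED in the tree from six Gay–Kirby / AGK
leaves by `Literature.Topology.FourManifolds.spc4_of_forall_isStablyTrivial_of_facts`
(TrisectionFunctorSPC4.lean): GK Thm 4 existence `exists_isBalancedGKTrisection`, GK Remark 2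
`gkTrisection_genus_eq_sum_of_homotopyEquiv_sphere`, marking
`exists_marking_centralSurface_of_gkTrisection`, AGK Thm 5 (a′)
`isGroupTrisection_groupGKTrisectionOf`, (b′) rigidity `diffeomorph_of_iso_groupGKTrisectionOf`,
(c′) stabilisation `exists_stabilized_gkTrisection` — of which two are already discharged in the
tree (`gkTrisection_genus_eq_sum_of_homotopyEquiv_sphere_holds`, TrisectionEulerProofs.lean;
`isGroupTrisection_groupGKTrisectionOf_holds`, TrisectionFunctorGKVanKampen.lea -/
@[route_item "route-SmoothPoincare4-CongruenceShadows"]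
def AgkCor6Sufficiency : Prop :=
  (∀ (k : ℕ) (K : Literature.Topology.FourManifolds.TrisectionKernels (3 * k)), Literature.Topology.FourManifolds.IsGroupTrisection (3 * k) k (PUnit : Type) K → K.IsStablyTrivial) → ∀ (M : Type) [TopologicalSpace M] [T2Space M] [SecondCountableTopology M], ContinuousMap.HomotopyEquiv.NonemptyDiffeomorphSphere M 4

/-- item stmt-SmoothPoincare4-14592 · crux · rank 2 · open · by planner
why it might fail: A theorem only through 3-manifold topology: geometric epimorphisms (GK90/LR02), Kneser–Stallings plus PERELMAN (free π₁ ⇒ #S¹×S²), Waldhausen 1968; no algebraic proof exists (Stallings' 'how not to prove Poincaré') and none of it is in Mathlib — vendoring depth XL, mis-vendoring is the live risk.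
sources: Waldhausen1968, GrigorchukKurchanov1990, LeiningerReid2002, Jaco1969, Perelman2002Entropy, Perelman2003a
[crux] group-theoretic Waldhausen (card P2, made load-bearing): for every (3+3m, m+1) group
trisection K of the trivial group and every i ≠ j there is ONE automorphism α of S_(3+3m) with
α(N_i) = K_i and α(N_j) = K_j. Route: K_i = ker of a geometric epimorphism onto F_g
(GrigorchukKurchanov1990, LeiningerReid2002), H_i ∪ H_j is closed with π₁ free of rank m+1 hence
#(S¹×S²) (Kneser–Stallings + Perelman, as in AGK p.4), Waldhausen: its genus-g splitting is
standard, i.e. diffeomorphic to the (i,j) pair of the standard trisection of S⁴; Dehn–Nielsen turns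
the diffeomorphism into α. [difficulty: XL] -/
@[route_item "route-SmoothPoincare4-CongruenceShadows"]
def WaldhausenPairs : Prop :=
  ∀ (m : ℕ) (K : Literature.Topology.FourManifolds.TrisectionKernels (3 + 3 * m)), Literature.Topology.FourManifolds.IsGroupTrisection (3 + 3 * m) (m + 1) (PUnit : Type) K → ∀ i j : Fin 3, i ≠ j → ∃ α : Literature.Topology.FourManifolds.SurfaceGroup (3 + 3 * m) ≃* Literature.Topology.FourManifolds.SurfaceGroup (3 + 3 * m), (Literature.Topology.FourManifolds.s4Kernels.stabilizeIter m i).map α.toMonoidHom = K i ∧ (Literature.Topology.FourManifolds.s4Kernels.stabilizeIter m j).map α.toMonoidHom = K j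

/-- item stmt-SmoothPoincare4-14593 · crux · rank 3 · open · by planner
why it might fail: Dunfield–Thurston mixing (Thm 7.4) is per simple quotient and only for g ≫ |Q|; solvable layers and simultaneity across strata are uncontrolled; one characteristic quotient (onto A₅, PSL₂(7), a 2-group) separating the standard (6;2,2,2) trisection of S⁴ from a Gluck-twist trisection refutes it.
sources: DunfieldThurston2005, BorovikLubotzkyMyasnikov2005, Myropolska2013, AbramsGayKirby2018, FellerEtAl2017, arXiv:1605.06731
[crux] BLIND, congruence form (card K2): for every (3+3m, m+1) group trisection K of the trivial
group and every characteristic finite-index M ≤ S = S_(3+3m) there is ψ ∈ Aut S with ψ(N_i)·M =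
K_i·M for i = 0,1,2 — in every characteristic finite quotient of the surface group the shadow of a
trisection of {1} is the shadow of the standard trisection of S⁴ ("formal fake 4-spheres do not
exist"; also no formally non-standard trisection of S⁴). [difficulty: L] -/
@[route_item "route-SmoothPoincare4-CongruenceShadows"]
def ShadowsStandard : Prop :=
  ∀ (m : ℕ) (K : Literature.Topology.FourManifolds.TrisectionKernels (3 + 3 * m)), Literature.Topology.FourManifolds.IsGroupTrisection (3 + 3 * m) (m + 1) (PUnit : Type) K → ∀ M : Subgroup (Literature.Topology.FourManifolds.SurfaceGroup (3 + 3 * m)), M.Characteristic → M.FiniteIndex → ∃ ψ : Literature.Topology.FourManifolds.SurfaceGroup (3 + 3 * m) ≃* Literature.Topology.FourManifolds.SurfaceGroup (3 + 3 * m), ∀ i : Fin 3, (Literature.Topology.FourManifolds.s4Kernels.stabilizeIter m i ⊔ M).map ψ.toMonoidHom = K i ⊔ M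

/-- item stmt-SmoothPoincare4-14594 · crux · rank 4 · open · by planner
why it might fail: Stronger than the card's Lie-level K1: equivalence under the IMAGE of Aut S_g in Aut(S/γ), an arithmetic group — Johnson-image (Morita trace) and class-number obstructions may separate orbits that the graded gate identity (defect 0 in the card's ten computed cases) cannot see.
sources: Lambertcole2019, Hain2008, FellerEtAl2017, arXiv:1901.10834, ZieschangVogtColdewey1980
[crux] BLIND, nilpotent form (the typable discrete analogue of card K1): for every (3+3m, m+1) group
trisection K of the trivial group and every c there is ψ ∈ Aut S with ψ(N_i)·γ_(c+2)S = K_i·γ_(c+2)S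
(γ = lower central series, γ_(c+2)S = `(⊤).lowerCentralSeries (c+1)`), i.e. the shadows in every
nilpotent quotient S/γ_(c+2)S are standard; c = 0 is the abelian (Lagrangian-triple) shadow.
[difficulty: L] -/
@[route_item "route-SmoothPoincare4-CongruenceShadows"]
def NilpotentShadowsStandard : Prop :=
  ∀ (m : ℕ) (K : Literature.Topology.FourManifolds.TrisectionKernels (3 + 3 * m)), Literature.Topology.FourManifolds.IsGroupTrisection (3 + 3 * m) (m + 1) (PUnit : Type) K → ∀ c : ℕ, ∃ ψ : Literature.Topology.FourManifolds.SurfaceGroup (3 + 3 * m) ≃* Literature.Topology.FourManifolds.SurfaceGroup (3 + 3 * m), ∀ i : Fin 3, (Literature.Topology.FourManifolds.s4Kernels.stabilizeIter m i ⊔ (⊤ : Subgroup (Literature.Topology.FourManifolds.SurfaceGroup (3 + 3 * m))).lowerCentralSeries (c + 1)).map ψ.toMonoidHom = K i ⊔ (⊤ : Subgroup (Literature.Topology.FourManifolds.SurfaceGroup (3 + 3 * m))).lowerCentralSeries (c + 1)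

/-- item stmt-SmoothPoincare4-14595 · crux · rank 5 · open · by planner
why it might fail: It is SPC4_g ∧ 4-d-Waldhausen_g at each genus: a non-standard balanced trisection of S⁴ itself (MSZ Conj 3.11, 'likely false') with standard shadows refutes it without touching SPC4; and completed stabilisers exceed closures by Ẑˣ-twists (NOTES), so no proof via 'pro-stabiliser = closure' exists.
sources: Artin1969, Hain2008, Boggi2014, BoggiFunar2020, LeiningerMcreynolds2005, MeierSchirmerZupan2016
[crux] APPROXIMATION (replaces card K3 ∧ K4 on the load path): a Waldhausen-normalised (3+3m, m+1)
group trisection K of the trivial group all of whose characteristic finite shadows are standard is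
standard: Iso N K (unstably, at its own genus). With ShadowsStandard this is the unstable gate AC ∩
BC ∩ T = (A∩B)C of the card, hence X (GateLogic). [deps: ShadowsStandard] [difficulty: open-problem] -/
@[route_item "route-SmoothPoincare4-CongruenceShadows"]
def ShadowApproximation : Prop :=
  ∀ (m : ℕ) (K : Literature.Topology.FourManifolds.TrisectionKernels (3 + 3 * m)), Literature.Topology.FourManifolds.IsGroupTrisection (3 + 3 * m) (m + 1) (PUnit : Type) K → (∀ i j : Fin 3, i ≠ j → ∃ α : Literature.Topology.FourManifolds.SurfaceGroup (3 + 3 * m) ≃* Literature.Topology.FourManifolds.SurfaceGroup (3 + 3 * m), (Literature.Topology.FourManifolds.s4Kernels.stabilizeIter m i).map α.toMonoidHom = K i ∧ (Literature.Topology.FourManifolds.s4Kernels.stabilizeIter m j).map α.toMonoidHom = K j) → (∀ M : Subgroup (Literature.Topology.FourManifolds.SurfaceGroup (3 + 3 * m)), M.Characteristic → M.FiniteIndex → ∃ ψ : Literature.Topology.FourManifolds.SurfaceGroup (3 + 3 * m) ≃* Literature.Topology.FourManifolds.SurfaceGroup (3 + 3 * m), ∀ i : Fin 3, (Literature.Topology.FourManifolds.s4Kernels.stabilizeIter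 m i ⊔ M).map ψ.toMonoidHom = K i ⊔ M) → Literature.Topology.FourManifolds.TrisectionKernels.Iso (Literature.Topology.FourManifolds.s4Kernels.stabilizeIter m) K

/-- item stmt-SmoothPoincare4-14596 · crux · rank 6 · open · by planner
why it might fail: Each factor is congruence-closed (Hopfian argument) and separable (L–McR Cor 1.4), but products of closed subgroups need not be closed (Ribes–Zalesskii is special to free groups), Stab(N̂) ⊋ cl(C) by unit twists, and congruence-closed exceeds profinitely-closed unless CSP(Mod_g), open for g ≥ 3.
sources: LeiningerMcreynolds2005, RibesZalesskii1993, Scott1978, Boggi2014, arXiv:2410.00556, arXiv:math/0505225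
[crux] SEP (card K4, congruence form, off the load path but its cleanest sub-question): the product
set (A∩B)·C ⊆ Aut S_(3+3m) — A∩B the stabiliser of the standard pair (N₀,N₁) (a genus-g Heegaard
group of #(S¹×S²)), C the stabiliser of N₂ (a handlebody group) — is closed in the congruence
topology: an automorphism ρ congruent modulo every characteristic finite-index M to some product x∘c
is itself a product x∘c. [difficulty: open-problem] -/
@[route_item "route-SmoothPoincare4-CongruenceShadows"]
def HeegaardHandlebodyCongruenceClosed : Prop :=
  ∀ (m : ℕ) (ρ : Literature.Topology.FourManifolds.SurfaceGroup (3 + 3 * m) ≃* Literature.Topology.FourManifolds.SurfaceGroup (3 + 3 * m)), (∀ M : Subgroup (Literature.Topology.FourManifolds.SurfaceGroup (3 + 3 * m)), M.Characteristic → M.FiniteIndex → ∃ x c : Literature.Topology.FourManifolds.SurfaceGroup (3 + 3 * m) ≃* Literature.Topology.FourManifolds.SurfaceGroup (3 + 3 * m), (Literature.Topology.FourManifolds.s4Kernels.stabilizeIter m 0).map x.toMonoidHom = Literature.Topology.FourManifolds.s4Kernels.stabilizeIter m 0 ∧ (Literature.Topology.FourManifolds.s4Kernels.stabilizeIter m 1).map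 x.toMonoidHom = Literature.Topology.FourManifolds.s4Kernels.stabilizeIter m 1 ∧ (Literature.Topology.FourManifolds.s4Kernels.stabilizeIter m 2).map c.toMonoidHom = Literature.Topology.FourManifolds.s4Kernels.stabilizeIter m 2 ∧ ∀ s, ρ s * (x (c s))⁻¹ ∈ M) → ∃ x c : Literature.Topology.FourManifolds.SurfaceGroup (3 + 3 * m) ≃* Literature.Topology.FourManifolds.SurfaceGroup (3 + 3 * m), (Literature.Topology.FourManifolds.s4Kernels.stabilizeIter m 0).map x.toMonoidHom = Literature.Topology.FourManifolds.s4Kernels.stabilizeIter m 0 ∧ (Literature.Topology.FourManifolds.s4Kernels.stabilizeIter m 1).map x.toMonoidHom = Literature.Topology.FourManifolds.s4Kernels.stabilizeIter m 1 ∧ (Literature.Topology.FourManifolds.s4Kernels.stabilizeIter m 2).map c.toMonoidHom = Literature.Topology.FourManifolds.s4Kernels.stabilizeIter m 2 ∧ ∀ s, ρ s = x (c s)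

/-- item stmt-SmoothPoincare4-15157 · crux · rank 7 · open · by planner
why it might fail: Theorem only via WZ19 Thm A (Kneser–Milnor + residual finiteness of 3-manifold groups = Perelman + goodness of aspherical 3-manifold groups) and Jaco–Hempel realisation; none in Mathlib (no prime decomposition, no handlebody gluing): vendoring depth XXL; without the Heegaard form, false (F_k × ℚ).
sources: WiltonZalesskii2019, arXiv:1703.03701, DixonFormanekPolandRibes1982, Hempel1976, Jaco1969, LeiningerReid2002
[crux] FACT DEBT PROMOTED (route-choice 2026-08-16, unit
rchoice-Summits-SmoothPoincare4-Smooth-679a086f: the XL-apex Literature named fact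
Literature.Topology.FourManifolds.isFreeOfRank_fundamentalGroup_of_sameFiniteQuotients,
Wilton–Zalesskii 2019 Thm A for #ᵏ(S¹×S²), enters this route only here). PROFINITE DETECTION OF
FREENESS FOR HEEGAARD-PAIR QUOTIENTS: for subgroups K₁, K₂ ≤ S_g whose normal closures have
quotients S_g/⟪K_i⟫ free of rank g (two handlebody kernels, Leininger–Reid Lemma 2.2), if the pair
quotient S_g/⟪K₁ ∪ K₂⟫ — π₁ of the closed orientable 3-manifold H₁ ∪ H₂ (Hempel Lemmas 14.4–14.5 =
Jaco 1969) — surjects onto exactly the finite groups that F_k surjects onto, then it is free of rank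
k. In print: Dixon–Formanek–Poland–Ribes (same finite quotients of f.g. groups ⇔ π̂ ≅ F̂_k) +
Wilton–Zalesskii Thm A = Thm 2.2 'profinite Kneser–Milnor' (arXiv:1703.03701, read) against N =
#ᵏ(S¹×S²) — Perelman inside (residual finiteness / Kneser–Milnor) — ⇒ Y ≅ #ᵏ(S¹×S²) ⇒ π₁Y ≅ F_k
(Hempel Ch. 3). USE: the signature is VERBATIM the hypothesis of the landed Theorems decl
Summit.SmoothPoincare4.SmoothPoincare4.Theorems.HeegaardHandlebodyCongruenceClosed.PairRigidityRetraction.stu -/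
@[route_item "route-SmoothPoincare4-CongruenceShadows"]
def HeegaardPairFreenessDetection : Prop :=
  ∀ (g k : ℕ) (K₁ K₂ : Subgroup (Literature.Topology.FourManifolds.SurfaceGroup g)), Literature.Topology.FourManifolds.IsFreeOfRank (Literature.Topology.FourManifolds.SurfaceGroup g ⧸ Subgroup.normalClosure (K₁ : Set (Literature.Topology.FourManifolds.SurfaceGroup g))) g → Literature.Topology.FourManifolds.IsFreeOfRank (Literature.Topology.FourManifolds.SurfaceGroup g ⧸ Subgroup.normalClosure (K₂ : Set (Literature.Topology.FourManifolds.SurfaceGroup g))) g → (∀ (Q : Type) [Group Q] [Finite Q], (∃ f : Literature.Topology.FourManifolds.SurfaceGroup g ⧸ Subgroup.normalClosure ((K₁ : Set (Literature.Topology.FourManifolds.SurfaceGroup g)) ∪ K₂) →* Q, Function.Surjective f) ↔ (∃ f : FreeGroup (Fin k) →* Q, Function.Surjective f)) → Literature.Topology.FourManifolds.IsFreeOfRank (Literature.Topology.FourManifolds.SurfaceGroup g ⧸ Subgroup.normalClosure ((K₁ : Set (Literature.Topology.FourManifolds.SurfaceGroup g)) ∪ K₂)) k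

/-- item stmt-SmoothPoincare4-15278 · crux · rank 8 · open · by planner
why it might fail: Published (Hempel L14.4–14.5 = Jaco 1969) and PROVED in tree modulo GK90 uniqueness of S_g↠F_g ∧ Dehn–Nielsen–Baer; risk = formalisation depth of those two leaves (Zieschang cancellation; twist generators realising Aut π₁), none in Mathlib — not truth; g<2 rides on the landed g↦g+3 stabilisation.
sources: Hempel1976, Jaco1969, LeiningerReid2002, arXiv:math/0202261, GrigorchukKurchanov1990, Zieschang1964
[crux] FACT DEBT PROMOTED (route-choice 2026-08-16, unit
rchoice-Summits-SmoothPoincare4-Smooth-fbcf7bc6): the XL-apex Literature named fact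
Literature.Topology.FourManifolds.exists_closedThreeManifold_fundamentalGroup_pairQuotient —
HEEGAARD-SPLITTING GROUPS ARE CLOSED 3-MANIFOLD GROUPS (Hempel 1976 Lemma 14.5 = Jaco 1969
realisation of a pair of handlebody kernels by a Heegaard splitting, with Lemma 14.4 Seifert–van
Kampen) — which enters this route through crux HeegaardPairFreenessDetection (stmt-15157;
Theorems/CongruenceShadowsHeegaardPairFreenessDetection.lean,
`HeegaardPairFreenessDetection_of_facts h₁ h₂ h₃`) and through stub P2 of crux
HeegaardHandlebodyCongruenceClosed (stmt-14596, line pair-rigidity-retraction;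
Theorems/…StubProfiniteFreenessDetection.lean, `stub_profiniteFreenessDetection_of_namedFacts h₁
h₂`). STATEMENT: for subgroups K₁, K₂ ≤ S_g whose normal closures have quotients free of rank g (two
handlebody kernels) there are a compact connected orientable smooth 3-manifold Y without boundary
(charts in ℝ³, Hausdorff, second countable) and y ∈ Y with π₁(Y, y) ≅ S_g ⧸ ⟪K₁ ∪ K₂⟫. The signature
is VERBATIM the body of the named fact at universe 0, so `(h : Heegaard -/
@[route_item "route-SmoothPoincare4-CongruenceShadows"]
def HeegaardPairQuotientRealisation : Prop :=
  ∀ (g : ℕ) (K₁ K₂ : Subgroup (Literature.Topology.FourManifolds.SurfaceGroup g)), Literature.Topology.FourManifolds.IsFreeOfRank (Literature.Topology.FourManifolds.SurfaceGroup g ⧸ Subgroup.normalClosure (K₁ : Set (Literature.Topology.FourManifolds.SurfaceGroup g))) g → Literature.Topology.FourManifolds.IsFreeOfRank (Literature.Topology.FourManifolds.SurfaceGroup g ⧸ Subgroup.normalClosure (K₂ : Set (Literature.Topology.FourManifolds.SurfaceGroup g))) g → ∃ (Y : Type) (_ : TopologicalSpace Y) (_ : T2Space Y) (_ : SecondCountableTopology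 Y) (_ : ChartedSpace (EuclideanSpace ℝ (Fin 3)) Y) (_ : IsManifold (𝓡 3) ((⊤ : ℕ∞) : WithTop ℕ∞) Y) (_ : CompactSpace Y) (_ : ConnectedSpace Y) (_ : Literature.Topology.FourManifolds.IsOrientable (𝓡 3) Y) (y : Y), Nonempty (FundamentalGroup Y y ≃* Literature.Topology.FourManifolds.SurfaceGroup g ⧸ Subgroup.normalClosure ((K₁ : Set (Literature.Topology.FourManifolds.SurfaceGroup g)) ∪ K₂))

-- item stmt-SmoothPoincare4-13527 · support · rank 7 · open · by planner — informal only, no Lean statement yet: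
--   [crux] LieGateIdentity (card artin-approximation-trisection-groups K1 (ii)+(iii), the Lie-level form
--   of NilpotentShadowsStandard; untyped until the definition request SurfaceLieAlgebraDer lands): let
--   𝔰_g (g = 3+3m) be the graded surface Lie algebra FreeLie(a₁…a_g, b₁…b_g)/(Σᵢ[aᵢ,bᵢ]) (= ⊕ γ_n
--   S_g/γ_{n+1} S_g ⊗ ℚ, Labute), Der⁺(𝔰_g) its positive-degree derivations, and 𝔞, 𝔟, 𝔠 ⊆ Der⁺(𝔰_g) the
--   stabiliser subalgebras of the three ideals generated by the coordinate Lagrangians of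
--   s4Kernels.stabilizeIter m (𝔞: the ideal of a-curves of N₀, etc.). Then in every degree n: (GATE)
--   (𝔞+𝔠) ∩ (𝔟+𝔠) = (𝔞∩𝔟)

/-- item stmt-SmoothPoincare4-15190 · support · rank 8 · open · by planner
[crux] FACT DEBT PROMOTED (route-choice 2026-08-16, unit
rchoice-Summits-SmoothPoincare4-Smooth-9faa3dd1): the XL-apex Literature named fact
`Literature.Topology.FourManifolds.GriffithsExtension` (H. B. Griffiths 1964, main theorem;
McCullough–Miller 1986 §1; Hensel 2020 Cor. 5.11), which enters this route only through crux
AgkCor6Sufficiency — line lp-by-sphere-system-surgery, registered stub `stub_griffiths`, consumed by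
the landed glue Theorems/CongruenceShadowsAgkCor6SufficiencyStubHandlebodyExtension
(`stub_handlebodyExtension : GriffithsExtension → HandlebodyExtension`, the two-handlebody form via
UNIQ). GRIFFITHS' HANDLEBODY EXTENSION THEOREM, smooth exact-restriction form: for a genus-g
handlebody H (`IsHandlebody g H`: compact, connected, orientable, one 0-handle and g 1-handles) with
ANY boundary datum b, a self-diffeomorphism ψ of ∂H = b.carrier whose induced map on π₁(∂H, x₀)
carries ker(π₁ ∂H → π₁ H) onto the same kernel at ψ x₀ extends to a self-diffeomorphism of H
(`b.DiffeoExtends ψ`: ∃ Ψ : H ≅ H, Ψ ∘ incl = incl ∘ ψ). The kernel condition is necessary (proved: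
`BoundaryData.DiffeoExtends.map_ker_eq_ker`), so this is Griffiths' iff. The signature is VERBATIM
the bod -/
@[route_item "route-SmoothPoincare4-CongruenceShadows"]
def GriffithsHandlebodyExtension : Prop :=
  ∀ (g : ℕ) (H : Type) [TopologicalSpace H] [T2Space H] [SecondCountableTopology H] [ChartedSpace (EuclideanHalfSpace 3) H] [IsManifold (𝓡∂ 3) ((⊤ : ℕ∞) : WithTop ℕ∞) H] (_ : Literature.Topology.FourManifolds.IsHandlebody g H) (b : Literature.Topology.FourManifolds.BoundaryData (𝓡∂ 3) H (𝓡 2)) (ψ : Diffeomorph (𝓡 2) (𝓡 2) b.carrier b.carrier ((⊤ : ℕ∞) : WithTop ℕ∞)) (x₀ : b.carrier), ((FundamentalGroup.map (⟨b.incl, b.continuous_incl⟩ : C(b.carrier, H)) x₀).ker).map (FundamentalGroup.map (⟨ψ, ψ.continuous⟩ : C(b.carrier, b.carrier)) x₀) = (FundamentalGroup.map (⟨b.incl, b.continuous_incl⟩ : C(b.carrier, H)) ((⟨ψ, ψ.continuous⟩ : C(b.carrier, b.carrier)) x₀)).ker → Literature.Topology.FourManifolds.BoundaryData.DiffeoExtends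 b ψ

/-- item stmt-SmoothPoincare4-14597 · support · rank 9 · closed · proved by Summit.SmoothPoincare4.SmoothPoincare4.Theorems.GateLogic_proof @ 9b35dfc6b665 (prover) · by planner
sources: AbramsGayKirby2018, Artin1969
[support] the Artin split is sound: ShadowsStandard → ShadowApproximation → NormalFormStablyTrivial
(given K normalised, BLIND supplies standard shadows, APPROXIMATION gives Iso N K =: α, and
IsStablyTrivial holds with n = 0 via α⁻¹). Proved in the planner folder (Sketch.lean, theorem
gateLogic_holds, lean check rc 0): copy it. [difficulty: provable-now] -/
@[route_item "route-SmoothPoincare4-CongruenceShadows"]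
def GateLogic : Prop :=
  ShadowsStandard → ShadowApproximation → NormalFormStablyTrivial

-- `GateLogic` holds: proved by `Summit.SmoothPoincare4.SmoothPoincare4.Theorems.GateLogic_proof` @ 9b35dfc6b665 (its module imports this route file, so no `_holds` link can be stated here).

/-- item stmt-SmoothPoincare4-14598 · support · rank 9 · closed · proved by Summit.SmoothPoincare4.SmoothPoincare4.Theorems.GenusZero_proof @ cf10271dcbae (prover) · by planner
sources: AbramsGayKirby2018, Literature.Topology.FourManifolds.s4Kernels_isStablyTrivial
[support] the k = 0 case of AGK's hypothesis: every (0,0) group trisection of the trivial group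
(kernel triple in the trivial group S₀) is stably trivial — one stabilisation is literally s4Kernels
transported along genShift 0 (Fin.natAdd 0 = id propositionally) and 3 + 3·0 = 0 + 3·1. [difficulty:
provable-now] -/
@[route_item "route-SmoothPoincare4-CongruenceShadows"]
def GenusZero : Prop :=
  ∀ K : Literature.Topology.FourManifolds.TrisectionKernels 0, Literature.Topology.FourManifolds.IsGroupTrisection 0 0 (PUnit : Type) K → K.IsStablyTrivial

-- `GenusZero` holds: proved by `Summit.SmoothPoincare4.SmoothPoincare4.Theorems.GenusZero_proof` @ cf10271dcbae (its module imports this route file, so no `_holds` link can be stated here).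

/-- item stmt-SmoothPoincare4-14599 · support · rank 9 · closed · proved by Summit.SmoothPoincare4.SmoothPoincare4.Theorems.AbelianShadowStandard.abelianShadowStandard_proof (prover) · by planner
sources: FellerEtAl2017, arXiv:1711.04762, ZieschangVogtColdewey1980
[support] the c = 0 rung of NilpotentShadowsStandard, provable by integral symplectic linear algebra
once H₁ of the presented surface group is identified with ℤ^(2g): the Lagrangian triple (L₀,L₁,L₂) ⊆
H₁(Σ_g;ℤ) of a (3+3m, m+1) group trisection of the trivial group (pairwise sums co-free of rank m+1,
total sum everything; FKSZ: H_*(X) = H_*(S⁴)) is carried to the standard triple by an automorphism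
of S_g (Aut S_g ↠ Sp±(2g,ℤ)). [difficulty: M] -/
@[route_item "route-SmoothPoincare4-CongruenceShadows"]
def AbelianShadowStandard : Prop :=
  ∀ (m : ℕ) (K : Literature.Topology.FourManifolds.TrisectionKernels (3 + 3 * m)), Literature.Topology.FourManifolds.IsGroupTrisection (3 + 3 * m) (m + 1) (PUnit : Type) K → ∃ ψ : Literature.Topology.FourManifolds.SurfaceGroup (3 + 3 * m) ≃* Literature.Topology.FourManifolds.SurfaceGroup (3 + 3 * m), ∀ i : Fin 3, (Literature.Topology.FourManifolds.s4Kernels.stabilizeIter m i ⊔ (⊤ : Subgroup (Literature.Topology.FourManifolds.SurfaceGroup (3 + 3 * m))).lowerCentralSeries 1).map ψ.toMonoidHom = K i ⊔ (⊤ : Subgroup (Literature.Topology.FourManifolds.SurfaceGroup (3 + 3 * m))).lowerCentralSeries 1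

-- `AbelianShadowStandard` holds: proved by `Summit.SmoothPoincare4.SmoothPoincare4.Theorems.AbelianShadowStandard.abelianShadowStandard_proof` (its module imports this route file, so no `_holds` link can be stated here).

/-- item stmt-SmoothPoincare4-14855 · support · rank 9 · open · by planner
why it might fail: Shadows give only LEVEL symmetries, and LevelSymmetriesLift / NormalisedLevelSymmetriesLift are FALSE (unit twists, Alexander units: ShadowApproximation Disproof §6–10), so x_M, c_M must be re-chosen per level; one level where im(A∩B)·ψ_M·im(C) holds no product for a homotopy-S⁴ trisection kills it.
sources: Artin1969, LeiningerMcreynolds2005, arXiv:math/0505225, Hain2008, arXiv:2206.10687, arXiv:2410.00556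
[support] CRUX-GRADE, filed as a rank-9 support only because the route stands at the gate's 7-crux /
15-item cap (route-repair rev 2; re-triage to crux when a slot frees). APPROXIMATION, closure form
(the 'CongruenceApproximable' child of ShadowApproximation foreseen in the Two-layer plan, filed to
put HeegaardHandlebodyCongruenceClosed on the load path): under exactly the hypotheses of
ShadowApproximation (K a (3+3m, m+1) group trisection of {1}, Waldhausen-normalised, all
characteristic finite shadows standard) there are a remarking α of the standard pair (α N₀ = K₀, α
N₁ = K₁) and a twist ρ of the third handlebody (α ρ N₂ = K₂) such that ρ is congruent modulo EVERY
characteristic finite-index M to a product x∘c with x ∈ Stab N₀ ∩ Stab N₁ and c ∈ Stab N₂ (exact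
stabilisers, re-chosen per level) — i.e. ρ lies in the congruence closure of (A∩B)·C.
ShadowApproximation ⇒ it (ρ = id) and it ∧ HeegaardHandlebodyCongruenceClosed ⇒ ShadowApproximation
(first conjunct of ArtinGates); both checked in the planner folder Sketch.lean (rc 0). Why it might
fail: Shadows give only LEVEL symmetries, and LevelSymmetriesLift / NormalisedLevelSymmetriesLift
are FALSE (unit twists, Alexander units: S -/
@[route_item "route-SmoothPoincare4-CongruenceShadows"]
def CongruenceApproximable : Prop :=
  ∀ (m : ℕ) (K : Literature.Topology.FourManifolds.TrisectionKernels (3 + 3 * m)), Literature.Topology.FourManifolds.IsGroupTrisection (3 + 3 * m) (m + 1) (PUnit : Type) K → (∀ i j : Fin 3, i ≠ j → ∃ α : Literature.Topology.FourManifolds.SurfaceGroup (3 + 3 * m) ≃* Literature.Topology.FourManifolds.SurfaceGroup (3 + 3 * m), (Literature.Topology.FourManifolds.s4Kernels.stabilizeIter m i).map α.toMonoidHom = K i ∧ (Literature.Topology.FourManifolds.s4Kernels.stabilizeIter m j).map α.toMonoidHom = K j) → (∀ M : Subgroup (Literature.Topology.FourManifolds.SurfaceGroup (3 + 3 * m)),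 M.Characteristic → M.FiniteIndex → ∃ ψ : Literature.Topology.FourManifolds.SurfaceGroup (3 + 3 * m) ≃* Literature.Topology.FourManifolds.SurfaceGroup (3 + 3 * m), ∀ i : Fin 3, (Literature.Topology.FourManifolds.s4Kernels.stabilizeIter m i ⊔ M).map ψ.toMonoidHom = K i ⊔ M) → ∃ α ρ : Literature.Topology.FourManifolds.SurfaceGroup (3 + 3 * m) ≃* Literature.Topology.FourManifolds.SurfaceGroup (3 + 3 * m), (Literature.Topology.FourManifolds.s4Kernels.stabilizeIter m 0).map α.toMonoidHom = K 0 ∧ (Literature.Topology.FourManifolds.s4Kernels.stabilizeIter m 1).map α.toMonoidHom = K 1 ∧ ((Literature.Topology.FourManifolds.s4Kernels.stabilizeIter m 2).map ρ.toMonoidHom).map α.toMonoidHom = K 2 ∧ ∀ M : Subgroup (Literature.Topology.FourManifolds.SurfaceGroup (3 + 3 * m)), M.Characteristic → M.FiniteIndex → ∃ x c : Literature.Topology.FourManifolds.SurfaceGroup (3 + 3 * m) ≃* Literature.Topology.FourManifolds.SurfaceGroup (3 + 3 * m), (Literature.Topology.FourManifolds.s4Kernels.stabilizeIter m 0).map x.toMonoidHom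 = Literature.Topology.FourManifolds.s4Kernels.stabilizeIter m 0 ∧ (Literature.Topology.FourManifolds.s4Kernels.stabilizeIter m 1).map x.toMonoidHom = Literature.Topology.FourManifolds.s4Kernels.stabilizeIter m 1 ∧ (Literature.Topology.FourManifolds.s4Kernels.stabilizeIter m 2).map c.toMonoidHom = Literature.Topology.FourManifolds.s4Kernels.stabilizeIter m 2 ∧ ∀ s, ρ s * (x (c s))⁻¹ ∈ M

/-- item stmt-SmoothPoincare4-14856 · support · rank 9 · open · by planner
why it might fail: It is SPC4_g ∧ 4-d-Waldhausen_g on its locus (a non-standard trisection of S⁴ with standard nilpotent shadows refutes it); the standardisations ψ_c need not stabilise in c — no finite class sees deep Johnson-kernel regluing and nothing bounds the depth (card K5: depth 1 is SPC4_g).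
sources: arXiv:1901.10834, Lambertcole2019, Hain2008, arXiv:2401.07705, AbramsGayKirby2018, MeierSchirmerZupan2016
[support] CRUX-GRADE, filed as a rank-9 support only because the route stands at the gate's 7-crux /
15-item cap (route-repair rev 2; re-triage to crux when a slot frees). APPROXIMATION, unipotent form
(the card's 'alternative third arrow at the unipotent level', K5/DET_g without a uniform depth; the
partner that puts NilpotentShadowsStandard on the load path): a Waldhausen-normalised (3+3m, m+1)
group trisection K of the trivial group all of whose nilpotent shadows are standard (for every c
some ψ_c ∈ Aut S carries N_i·γ_(c+2)S onto K_i·γ_(c+2)S, i = 0,1,2 — verbatim the conclusion of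
NilpotentShadowsStandard) is standard: Iso N K (unstably, at its own genus). With
NilpotentShadowsStandard this is again the unstable gate, hence X (second conjunct of ArtinGates,
checked in the planner folder Sketch.lean, rc 0). Why it might fail: It is SPC4_g ∧ 4-d-Waldhausen_g
on its locus (a non-standard trisection of S⁴ with standard nilpotent shadows refutes it); the
standardisations ψ_c need not stabilise in c — no finite class sees deep Johnson-kernel regluing and
nothing bounds the depth (card K5: depth 1 is SPC4_g). [deps: NilpotentShadowsStandard] [difficulty:
open-problem] -/
@[route_item "route-SmoothPoincare4-CongruenceShadows"]
def NilpotentApproximation : Prop :=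
  ∀ (m : ℕ) (K : Literature.Topology.FourManifolds.TrisectionKernels (3 + 3 * m)), Literature.Topology.FourManifolds.IsGroupTrisection (3 + 3 * m) (m + 1) (PUnit : Type) K → (∀ i j : Fin 3, i ≠ j → ∃ α : Literature.Topology.FourManifolds.SurfaceGroup (3 + 3 * m) ≃* Literature.Topology.FourManifolds.SurfaceGroup (3 + 3 * m), (Literature.Topology.FourManifolds.s4Kernels.stabilizeIter m i).map α.toMonoidHom = K i ∧ (Literature.Topology.FourManifolds.s4Kernels.stabilizeIter m j).map α.toMonoidHom = K j) → (∀ c : ℕ, ∃ ψ : Literature.Topology.FourManifolds.SurfaceGroup (3 + 3 * m) ≃* Literature.Topology.FourManifolds.SurfaceGroup (3 + 3 * m), ∀ i : Fin 3, (Literature.Topology.FourManifolds.s4Kernels.stabilizeIter m i ⊔ (⊤ : Subgroup (Literature.Topology.FourManifolds.SurfaceGroup (3 + 3 * m))).lowerCentralSeries (c + 1)).map ψ.toMonoidHom = K i ⊔ (⊤ : Subgroup (Literature.Topology.FourManifolds.SurfaceGroup (3 + 3 * m))).lowerCentralSeries (c + 1)) → Literature.Topology.FourManifolds.TrisectionKernels.Iso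 (Literature.Topology.FourManifolds.s4Kernels.stabilizeIter m) K

/-- item stmt-SmoothPoincare4-14857 · support · rank 9 · closed · proved by Summit.SmoothPoincare4.SmoothPoincare4.Theorems.ArtinGates_proof @ e73baeff714a (prover) · by planner
sources: Artin1969, AbramsGayKirby2018
[support] the two remaining Artin gates are sound (one item because of the 15-item cap; each
conjunct is pure logic): (SEP) CongruenceApproximable → HeegaardHandlebodyCongruenceClosed →
ShadowApproximation — take α, ρ from CongruenceApproximable, HHCC turns the level-wise products into
ρ = x∘c, and φ := α∘x carries N to K (φN₂ = αx(cN₂) = αρN₂ = K₂); (UNIPOTENT)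
NilpotentShadowsStandard → NilpotentApproximation → NormalFormStablyTrivial — the proof of GateLogic
(Theorems/CongruenceShadowsGateLogic.lean) verbatim with nilpotent shadows (Iso N K =: α,
IsStablyTrivial with n = 0 via α⁻¹). Proved in the planner folder (Sketch.lean: sepGateLogic_holds,
nilpotentGateLogic_holds, artinGates_holds; lean check rc 0, 0 sorries): copy it. [difficulty:
provable-now] -/
@[route_item "route-SmoothPoincare4-CongruenceShadows"]
def ArtinGates : Prop :=
  (CongruenceApproximable → HeegaardHandlebodyCongruenceClosed → ShadowApproximation) ∧ (NilpotentShadowsStandard → NilpotentApproximation → NormalFormStablyTrivial)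

-- `ArtinGates` holds: proved by `Summit.SmoothPoincare4.SmoothPoincare4.Theorems.ArtinGates_proof` @ e73baeff714a (its module imports this route file, so no `_holds` link can be stated here).

/-- item stmt-SmoothPoincare4-14600 · assembly · rank 1 · closed · proved by Summit.SmoothPoincare4.SmoothPoincare4.Theorems.CongruenceShadows_Assembly_proof @ f949646b2fdc (prover) · by planner
sources: AbramsGayKirby2018, Waldhausen1968
[assembly] NormalFormStablyTrivial → WaldhausenPairs → GenusZero → AgkCor6Sufficiency →
SmoothPoincare4. -/
@[route_item "route-SmoothPoincare4-CongruenceShadows"]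
def Assembly : Prop :=
  NormalFormStablyTrivial → WaldhausenPairs → GenusZero → AgkCor6Sufficiency → _root_.SmoothPoincare4

-- `Assembly` holds: proved by `Summit.SmoothPoincare4.SmoothPoincare4.Theorems.CongruenceShadows_Assembly_proof` @ f949646b2fdc (its module imports this route file, so no `_holds` link can be stated here).

/-! D-0027 §2.1 — DECIDING THEOREM (planner-authored via `route open/edit --closes-file`; by planner-plancard-SmoothPoincare4-SmoothPoinca-27299605-0 2026-08-15T19:09:54Z):
its hypotheses are this route's items and its conclusion the sub-problem Statement (glue_lint), and it elaborates with this file. -/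

@[closes "route-SmoothPoincare4-CongruenceShadows"] theorem closes (hX : NormalFormStablyTrivial) (hW : WaldhausenPairs) (h0 : GenusZero)
    (hAGK : AgkCor6Sufficiency) : _root_.SmoothPoincare4 := by
  refine hAGK ?_
  intro k K hK
  cases k with
  | zero => exact h0 K hK
  | succ m =>
    have key : ∀ (g : ℕ) (K' : Literature.Topology.FourManifolds.TrisectionKernels g), g = 3 + 3 * m →
        Literature.Topology.FourManifolds.IsGroupTrisection g (m + 1) (PUnit : Type) K' → K'.IsStablyTrivial := by
      intro g K' hg hK'
      subst hg
      exact hX m K' hK' (hW m K' hK')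
    exact key (3 * (m + 1)) K (by ring) hK

end Summit.SmoothPoincare4.SmoothPoincare4.Theses.CongruenceShadows
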